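import Summits.HodgeConjecture.FermatCycles.ShiodaConditionFourfoldNormalized
import HarnessLib

/-!
# Shioda's condition `(P⁴₉₃)`, kernel-checked — part A (case U, `b < 27`)

HONEST FRAMING: explicit algebraic cycles for specific Hodge classes on Fermat/Delsarte varieties;
residual open instances listed; no claim on general Hodge.

Cell `pub-hfermat`, topic path `Summits/HodgeConjecture/FermatCycles/` (new work, not literature). By the unit-normalised sound search of
`ShiodaConditionFourfoldNormalized.lean` (`shiodaConditionUpTo_four_of_normalized`): case U (`1 ∈ s`) in chunks `b ∈ [1, 11)`, `[11, 19)`, `[19, 27)`, `[27, 37)`, `[37, 93)`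
(69 886 + 66 898 + 68 647 + 68 115 + 29 709 sorted tuples) and case N (all six entries among the `32` non-units of `ℤ/93`, 39 726 tuples), each by
`decide +kernel`; cross-checked by `code/lit/p39/proto_norm.py 93` (1158 + 816 Hodge multisets; 1156 + 816 carry a pair `{a, −a}`, 2 are
quasi-decomposable, 0 semi-only, 0 failures) and by the cell's P4-TABLE (two implementations + referee). `93 = 3·31` is one of the six
degrees `39, 51, 57, 69, 87, 93 ≤ 100` at which the cell's enumeration finds `(P⁴ₘ)` TRUE while refereed print neither verifies `(P⁴ₘ)`
(verified: `m` prime or `m ≤ 20`, all `n`, and `m = 21`, `n ≤ 10` [Shioda1979PJA, §2]; `m = 21, 27`, all `n` [daSilva2021HodgeFermat, Thm 3.3])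
nor proves HC(X⁴ₘ) otherwise (`3 ∣ m`: outside [daSilva2021HodgeFermat, Prop. 3.1], `m ≤ 100` coprime to `6`; outside Aoki's `pᵉ`, `2pᵉ` and
`{2,3,5,7}`-smooth degrees). PUBLIC PRIORITY: the computer-assisted preprint [Jumagulov2026OddFermatFourfolds] (arXiv:2608.18134, July 2026)
asserts HC(X⁴ₘ) for every odd `m ≤ 199` (its Thm 1.1) through a census of the Galois orbits of Hodge (2,2) characters (its Thm 1.5) whose
Appendix C row `m = 93` — 646 orbits = 645 decomposable + 1 quasi-decomposable + 0 other — is `(P⁴₉₃)`; the cell reproduces that row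
by two independent enumerations (`code/lit/census/orbits.py --method norm | brute`). This file is an INDEPENDENT certificate of `(P⁴₉₃)`
checked by the Lean kernel, not a first claim.
This part A holds the case-U chunks with `b < 27` (69 886 + 66 898 + 68 647 tuples); part B
(`ShiodaConditionFourfoldNinetyThree.lean`) the remaining chunks, case N and the theorem `shiodaConditionUpTo_ninetyThree_four`.

References: [Shioda1979PJA] T. Shioda, Proc. Japan Acad. 55A (1979) §1 (condition (Pⁿₘ)), §2 Thm 1; [daSilva2021HodgeFermat]
G. da Silva Jr., Experimental Results 2 (2021) e22, Def. 2.4, Prop. 3.1, Thm 3.3; [Jumagulov2026OddFermatFourfolds] R. Jumagulov,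
arXiv:2608.18134 (preprint, July 2026), Thm 1.1, Thm 1.5, Appendix C.
-/

namespace Summit.HodgeConjecture.FermatCycles.ShiodaConditionFourfold

open Multiset
open Literature.AlgebraicGeometry.HodgeTheory Literature.AlgebraicGeometry.HodgeTheory.FermatCharacter

set_option maxHeartbeats 0 in
/-- Case U at `N = 93`, `b ∈ [1, 11)` (69 886 tuples). Kernel. [cite: Shioda1979PJA, §1 condition (Pⁿₘ), n = 4] -/
theorem checkU_93_1 : checkU 93 1 10 = true := by decide +kernel

set_option maxHeartbeats 0 in
/-- Case U at `N = 93`, `b ∈ [11, 19)` (66 898 tuples). Kernel. [cite: Shioda1979PJA, §1 condition (Pⁿₘ), n = 4] -/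
theorem checkU_93_11 : checkU 93 11 8 = true := by decide +kernel

set_option maxHeartbeats 0 in
/-- Case U at `N = 93`, `b ∈ [19, 27)` (68 647 tuples). Kernel. [cite: Shioda1979PJA, §1 condition (Pⁿₘ), n = 4] -/
theorem checkU_93_19 : checkU 93 19 8 = true := by decide +kernel

end Summit.HodgeConjecture.FermatCycles.ShiodaConditionFourfold
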